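import Mathlib
import Summits.ValiantsHypothesis.ValiantsHypothesis.Theorems.FifoMatchingNNNotVPCliqueProgramDefs
import HarnessLib

/-!
# Route FifoMatching — crux `NNNotVP` (stmt-ValiantsHypothesis-11615), line `division_split`:
# the clique token program — API of positions, registers and round labels

Companion of `Theorems/FifoMatchingNNNotVPCliqueProgramDefs.lean` (the program) and of the
token-game framework (`…TokenGame`, `…TokenGameMatching`, `…RoundStructure`, `…Program`).

* `filt` projections / injectivity / the lexicographic order (`filt_lt_filt_iff`,
  `filt_zero_lt_filt_one_iff`: inside a block a side-`0` position precedes a side-`1` position iff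
  its bucket is `≤`), register access, `key_eq_of_filter` (THE BUCKET FILTER: non-crossing
  before and after reversing the buckets forces equal buckets), the CHECK label (`chk_last`,
  `elim_chk_castSucc_iff`);
* what each round label says when switched on: `lab0_on_iff`, `labA_on_iff_even/odd`,
  `labB_on_iff`, `labC_on_iff_zero/pos/one`, `labE_on_iff`, `cliqueLab_eq`.

Honest framing: bookkeeping for the gadget; ACCEPT / REJECT and stub A are in the companions; the
crux `NNNotVP` and `VP ≠ VNP` stay OPEN (NOT proved).  No definitions, no named facts.
-/

noncomputable section

-- Sub = Summit single-conjunct layout: the duplicated namespace component is mandated by the tree.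
set_option linter.dupNamespace false

namespace Summit.ValiantsHypothesis.ValiantsHypothesis.Theorems.FifoMatching.NNNotVP.DivisionSplit

open Literature.Computability.Complexity
open scoped Classical

/-! ### Basic API of positions and registers -/

section Basics

variable {k m : ℕ}

/-- Projections of `filt`. [folklore] -/
@[simp] theorem blkOf_filt (b : Fin k) (κ : Fin (m + 1)) (s : Fin 2) (w : Fin (regCard m)) :
    blkOf (filt b κ s w) = b := rfl
/-- Projections of `filt`. [folklore] -/
@[simp] theorem keyOf_filt (b : Fin k) (κ : Fin (m + 1)) (s : Fin 2) (w : Fin (regCard m)) :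
    keyOf (filt b κ s w) = κ := rfl
/-- Projections of `filt`. [folklore] -/
@[simp] theorem sideOf_filt (b : Fin k) (κ : Fin (m + 1)) (s : Fin 2) (w : Fin (regCard m)) :
    sideOf (filt b κ s w) = s := rfl
/-- Projections of `filt`. [folklore] -/
@[simp] theorem valOf_filt (b : Fin k) (κ : Fin (m + 1)) (s : Fin 2) (w : Fin (regCard m)) :
    valOf (filt b κ s w) = w := rfl

/-- Every position is a `filt`. [folklore] -/
theorem filt_eta (q : Pos k m) : filt (blkOf q) (keyOf q) (sideOf q) (valOf q) = q := rfl

/-- `filt` is injective. [folklore] -/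
theorem filt_inj {b b' : Fin k} {κ κ' : Fin (m + 1)} {s s' : Fin 2} {w w' : Fin (regCard m)} :
    filt b κ s w = filt b' κ' s' w' ↔ b = b' ∧ κ = κ' ∧ s = s' ∧ w = w' := by
  constructor
  · intro h
    exact ⟨congrArg blkOf h, congrArg keyOf h, congrArg sideOf h, congrArg valOf h⟩
  · rintro ⟨rfl, rfl, rfl, rfl⟩; rfl

/-- `home i w = filt i 0 0 w`. [folklore] -/
theorem home_eq (i : Fin k) (w : Fin (regCard m)) : home i w = filt i 0 0 w := rfl

/-- The lexicographic order of positions. [folklore] -/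
theorem filt_lt_filt_iff {b b' : Fin k} {κ κ' : Fin (m + 1)} {s s' : Fin 2}
    {w w' : Fin (regCard m)} :
    filt b κ s w < filt b' κ' s' w' ↔
      b < b' ∨ (b = b' ∧ (κ < κ' ∨ (κ = κ' ∧ (s < s' ∨ (s = s' ∧ w < w'))))) := by
  simp only [filt, Prod.Lex.toLex_lt_toLex]

/-- The FILTER comparison: inside one block, a side-`0` position precedes a side-`1` position iff
its bucket is at most the other's. [folklore] -/
theorem filt_zero_lt_filt_one_iff {b : Fin k} {κ κ' : Fin (m + 1)} {w w' : Fin (regCard m)} :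
    filt b κ 0 w < filt b κ' 1 w' ↔ κ ≤ κ' := by
  rw [filt_lt_filt_iff]
  constructor
  · rintro (h | ⟨-, h | ⟨h, -⟩⟩)
    · exact absurd h (lt_irrefl _)
    · exact h.le
    · exact h.le
  · intro h
    rcases h.lt_or_eq with h | h
    · exact Or.inr ⟨rfl, Or.inl h⟩
    · exact Or.inr ⟨rfl, Or.inr ⟨h, Or.inl (by decide)⟩⟩

/-- Positions in a smaller block come first. [folklore] -/
theorem filt_lt_filt_of_blk_lt {b b' : Fin k} (h : b < b') (κ κ' : Fin (m + 1)) (s s' : Fin 2)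
    (w w' : Fin (regCard m)) : filt b κ s w < filt b' κ' s' w' :=
  filt_lt_filt_iff.2 (Or.inl h)

/-- Register access of `mkRegs`. [folklore] -/
@[simp] theorem aOf_mkRegs (a : Fin m) (b c : Fin (m + 1)) : aOf (mkRegs a b c) = a := by
  simp [aOf, mkRegs]
/-- Register access of `mkRegs`. [folklore] -/
@[simp] theorem bOf_mkRegs (a : Fin m) (b c : Fin (m + 1)) : bOf (mkRegs a b c) = b := by
  simp [bOf, mkRegs]
/-- Register access of `mkRegs`. [folklore] -/
@[simp] theorem cOf_mkRegs (a : Fin m) (b c : Fin (m + 1)) : cOf (mkRegs a b c) = c := by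
  simp [cOf, mkRegs]
/-- Every register state is a `mkRegs`. [folklore] -/
theorem mkRegs_eta (w : Fin (regCard m)) : mkRegs (aOf w) (bOf w) (cOf w) = w := by
  simp [aOf, bOf, cOf, mkRegs]

/-- The reversed buckets compare in reverse. [folklore] -/
theorem revKey_le_revKey_iff {κ κ' : Fin (m + 1)} : revKey κ ≤ revKey κ' ↔ κ' ≤ κ :=
  Fin.rev_le_rev

/-- **The bucket filter.**  Two tokens in one block, sides `0` and `1`, that do not cross before
and after reversing the buckets carry the same bucket. [folklore] -/
theorem key_eq_of_filter {b : Fin k} {κ κ' : Fin (m + 1)} {w₁ w₁' w₂ w₂' : Fin (regCard m)}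
    (h1 : filt b κ 0 w₁ < filt b κ' 1 w₁')
    (h2 : filt b (revKey κ) 0 w₂ < filt b (revKey κ') 1 w₂') : κ' = κ :=
  le_antisymm (revKey_le_revKey_iff.1 (filt_zero_lt_filt_one_iff.1 h2))
    (filt_zero_lt_filt_one_iff.1 h1)

/-- The CHECK label on a blank is free. [folklore] -/
theorem chk_last (a : Fin m) : chk a (Fin.last m) = Sum.inr true := by
  unfold chk
  rw [dif_neg (by simp)]

/-- The CHECK label on a real value `c`: switched on under `y` iff `a ≠ c` and the edge `{a, c}`
is on. [folklore] -/
theorem elim_chk_castSucc_iff (y : KEdge m → Bool) (a c : Fin m) :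
    Sum.elim y id (chk a (Fin.castSucc c)) = true ↔
      ∃ h : a ≠ c, y ⟨s(a, c), by rwa [SimpleGraph.mem_edgeSet, SimpleGraph.top_adj]⟩ = true := by
  unfold chk
  have hc : (Fin.castSucc c).val < m := by simp
  rw [dif_pos hc]
  have hcc : (⟨(Fin.castSucc c).val, hc⟩ : Fin m) = c := Fin.ext (by simp)
  simp only [hcc]
  by_cases h : a = c
  · rw [dif_pos h]; simp [h]
  · rw [dif_neg h]; simp [h]

end Basics

/-! ### What the labels say -/

section Labels

variable {k m : ℕ} (y : KEdge m → Bool)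

/-- A switched-on label is not the absent arc. [folklore] -/
theorem elim_inr_false : Sum.elim y id (Sum.inr false : KEdge m ⊕ Bool) = false := rfl

/-- GUESS: token `i` enters `home i (a, a, blank)`. [folklore] -/
theorem lab0_on_iff (i : Fin k) (q : Pos k m) :
    Sum.elim y id (lab0 i q) = true ↔
      ∃ a : Fin m, q = home i (mkRegs a (Fin.castSucc a) (Fin.last m)) := by
  unfold lab0
  split_ifs with h <;> simp [h]

/-- Round A on an even token at home. [folklore] -/
theorem labA_on_iff_even {i : Fin k} (hi : i.val % 2 = 0) (w : Fin (regCard m)) (q' : Pos k m) :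
    Sum.elim y id (labA (home i w) q') = true ↔ q' = filt i (bOf w) 0 w := by
  unfold labA
  simp only [home_eq, blkOf_filt, keyOf_filt, sideOf_filt, valOf_filt, hi, and_self, if_true]
  split_ifs with h <;> simp [h]

/-- Round A on an odd token at home. [folklore] -/
theorem labA_on_iff_odd {i : Fin k} (hi : i.val % 2 = 1) (w : Fin (regCard m)) (q' : Pos k m) :
    Sum.elim y id (labA (home i w) q') = true ↔
      ∃ κ : Fin (m + 1), q' = filt ⟨i.val - 1, by omega⟩ κ 1 (mkRegs (aOf w) (bOf w) κ) := by
  unfold labA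
  simp only [home_eq, blkOf_filt, keyOf_filt, sideOf_filt, valOf_filt, hi, and_self, if_true,
    Nat.one_ne_zero, if_false]
  split_ifs with h <;> simp [h]

/-- Rounds B / D: reverse the bucket. [folklore] -/
theorem labB_on_iff (b : Fin k) (κ : Fin (m + 1)) (s : Fin 2) (w : Fin (regCard m))
    (q' : Pos k m) :
    Sum.elim y id (labB (filt b κ s w) q') = true ↔ q' = filt b (revKey κ) s w := by
  unfold labB
  simp only [blkOf_filt, keyOf_filt, sideOf_filt, valOf_filt]
  split_ifs with h <;> simp [h]

/-- Round C on token `0` (side `0`, block `0`): stage blank, go home. [folklore] -/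
theorem labC_on_iff_zero {b : Fin k} (hb : b.val = 0) (κ : Fin (m + 1)) (w : Fin (regCard m))
    (q' : Pos k m) :
    Sum.elim y id (labC (filt b κ 0 w) q') = true ↔
      q' = home b (mkRegs (aOf w) (bOf w) (Fin.last m)) := by
  unfold labC
  simp only [blkOf_filt, sideOf_filt, valOf_filt, hb, if_true]
  split_ifs with h <;> simp [h]

/-- Round C on an even token `i ≥ 2` (side `0`, block `i`): stage any `κ'`. [folklore] -/
theorem labC_on_iff_pos {b : Fin k} (hb : b.val ≠ 0) (κ : Fin (m + 1)) (w : Fin (regCard m))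
    (q' : Pos k m) :
    Sum.elim y id (labC (filt b κ 0 w) q') = true ↔
      ∃ κ' : Fin (m + 1), q' = filt ⟨b.val - 1, by omega⟩ κ' 1 (mkRegs (aOf w) (bOf w) κ') := by
  unfold labC
  simp only [blkOf_filt, sideOf_filt, valOf_filt, hb, if_true, if_false]
  split_ifs with h <;> simp [h]

/-- Round C on an odd token `i = b + 1` (side `1`, block `b`): go to `filt (b+1) b_reg 0 w`.
[folklore] -/
theorem labC_on_iff_one {b : Fin k} (hb : b.val + 1 < k) (κ : Fin (m + 1)) (w : Fin (regCard m))
    (q' : Pos k m) :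
    Sum.elim y id (labC (filt b κ 1 w) q') = true ↔ q' = filt ⟨b.val + 1, hb⟩ (bOf w) 0 w := by
  unfold labC
  simp only [blkOf_filt, sideOf_filt, valOf_filt]
  rw [if_neg (by decide), dif_pos hb]
  split_ifs with h <;> simp [h]

/-- Round E: token `i = b + s` commits `b := c`, goes home, along the CHECK label. [folklore] -/
theorem labE_on_iff {b : Fin k} {s : Fin 2} (hbs : b.val + s.val < k) (κ : Fin (m + 1))
    (w : Fin (regCard m)) (q' : Pos k m) :
    Sum.elim y id (labE (filt b κ s w) q') = true ↔
      q' = home ⟨b.val + s.val, hbs⟩ (mkRegs (aOf w) (cOf w) (cOf w)) ∧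
        Sum.elim y id (chk (aOf w) (cOf w)) = true := by
  unfold labE
  simp only [blkOf_filt, sideOf_filt, valOf_filt, hbs, dif_pos]
  split_ifs with h <;> simp [h]

/-- The program's round `j` is the label of kind `j % 5`. [folklore] -/
theorem cliqueLab_eq {R : ℕ} (j : Fin R) (q q' : Pos k m) :
    cliqueLab j q q' =
      if j.val % 5 = 0 then labA q q' else if j.val % 5 = 1 then labB q q'
      else if j.val % 5 = 2 then labC q q' else if j.val % 5 = 3 then labB q q' else labE q q' :=
  rfl

end Labels

end Summit.ValiantsHypothesis.ValiantsHypothesis.Theorems.FifoMatching.NNNotVP.DivisionSplit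

end
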